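import Summits.CriticalPhenomena.PercolationContinuityZ3.Theorems.PercNearOneGluingNoHeavyPcintNawChainMem
import HarnessLib

/-!
# PCINT lane, reduction B2c on the dangerous-set automaton — semantics of the step data along a neighbour-avoiding word

Cell `prim-pcint` (PAPER-2 track (iii)), seat `prim-pcint-1` (gen 5); support file (`--supports stmt-CriticalPhenomena-4575`).
Does NOT build on p205010.  Memo: run/shared/lean/prim/pcint/REDUCTIONS.md §B2c (prim-pcint-2 gen 3), §B2c.7 (reduced states).

Parity on `ℤ^d` (`spar`: two vertices of a word adjacent to a common site have indices of equal parity), unit-vector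
geometry (`fst_ne_of_stepVec_ne`, `stepVec_injective`), and what the chain rule's data mean along a NAW word whose states are
the dangerous sets `danger τ (pre a₀ γ t)`: `cvis_spec` (visible incidences are genuine), `mem_cvis_of_adj` (RETENTION: an
incidence of age `≤ τ-3` is visible), `nsite_not_mem_pathSites` (active neighbours are off the path), `forced_of_cuncond`
(unconditional payments are at sites forced for every order), `nsite_eq_cornerSite` + `forced_of_ccorner` (conditional payments
are at the corner site, which is forced whenever the corner is bad).
-/

noncomputable section

namespace Summit.CriticalPhenomena.PercolationContinuityZ3.Theorems.Pcint

open Finset Literature.Probability.Percolation Literature.Probability.LatticeModels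
open Literature.Probability.FitznerVanDerHofstad2017 (wordPos_wordInit)

variable {{d : ℕ}}

/-! ### Parity and unit-vector geometry on `ℤ^d` -/

section Geometry

variable {d : ℕ}

/-- Coordinate-sum parity of a site. [folklore] -/
def spar (x : Site d) : ZMod 2 := ∑ i, ((x i : ℤ) : ZMod 2)

/-- Parity is additive. [folklore] -/
theorem spar_add (x y : Site d) : spar (x + y) = spar x + spar y := by
  simp only [spar, Pi.add_apply, Int.cast_add, Finset.sum_add_distrib]

/-- A unit step has odd parity. [folklore] -/
theorem spar_stepVec (a : Fin d × Bool) : spar (stepVec a) = 1 := by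
  unfold spar
  rw [Finset.sum_eq_single a.1 (fun i _ hi => by rw [stepVec_apply_of_ne a hi, Int.cast_zero]) (fun h => absurd (mem_univ _) h),
    stepVec_apply_fst]
  cases a.2
  · simp only [Bool.false_eq_true, if_false, Int.cast_neg, Int.cast_one]; decide
  · simp

/-- Adjacent sites have opposite parities. [folklore] -/
theorem spar_of_adj {x y : Site d} (h : (zdGraph d).Adj x y) : spar y = spar x + 1 := by
  obtain ⟨a, rfl⟩ := (zdGraph_adj_iff_stepVec x y).1 h
  rw [spar_add, spar_stepVec]

/-- The parity of the `k`-th vertex of a word is `k`. [folklore] -/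
theorem spar_wordPos {n : ℕ} (γ : Fin n → Fin d × Bool) : ∀ {k : ℕ}, k ≤ n → spar (wordPos γ k) = k
  | 0, _ => by simp [spar]
  | k + 1, hk => by
    rw [wordPos_succ γ (by omega : k < n), spar_add, spar_stepVec, spar_wordPos γ (by omega : k ≤ n)]; push_cast; ring

/-- **Two vertices of a word adjacent to a common site have indices of equal parity.** [folklore] -/
theorem mod_two_eq_of_adj_adj {n : ℕ} (γ : Fin n → Fin d × Bool) {i k : ℕ} (hi : i ≤ n) (hk : k ≤ n) {W : Site d}
    (h1 : (zdGraph d).Adj (wordPos γ i) W) (h2 : (zdGraph d).Adj (wordPos γ k) W) : i % 2 = k % 2 := by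
  have e1 := spar_of_adj h1
  have e2 := spar_of_adj h2
  rw [spar_wordPos γ hi] at e1
  rw [spar_wordPos γ hk] at e2
  have : ((i : ℕ) : ZMod 2) = (k : ℕ) := by
    have := e1.symm.trans e2; exact add_right_cancel this
  exact (ZMod.natCast_eq_natCast_iff' i k 2).1 this

/-- Unit steps that are neither equal nor opposite lie on different axes. [folklore] -/
theorem fst_ne_of_stepVec_ne {a b : Fin d × Bool} (h1 : stepVec a ≠ stepVec b) (h2 : stepVec a ≠ -stepVec b) : a.1 ≠ b.1 := by
  intro hab
  rcases a with ⟨i, s⟩; rcases b with ⟨j, s'⟩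
  simp only at hab; subst hab
  cases s <;> cases s' <;> simp [stepVec] at h1 h2

/-- `stepVec` is injective. [folklore] -/
theorem stepVec_injective : Function.Injective (stepVec : Fin d × Bool → Site d) := by
  intro a b h
  have h1 : a.1 = b.1 := fst_eq_of_stepVec_eq h
  have h2 := congrFun h a.1
  rw [stepVec_apply_fst, h1, stepVec_apply_fst] at h2
  rcases a with ⟨i, s⟩; rcases b with ⟨j, s'⟩
  simp only at h1 h2; subst h1
  cases s <;> cases s' <;> first | rfl | (norm_num at h2)

/-- The `ℓ¹` distance between adjacent sites is one. [folklore] -/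
theorem l1_sub_of_adj {x y : Site d} (h : (zdGraph d).Adj x y) : l1 (x - y) = 1 := by
  obtain ⟨a, rfl⟩ := (zdGraph_adj_iff_stepVec x y).1 h
  rw [sub_add_cancel_left, l1_neg, l1_stepVec]

end Geometry

/-! ### Semantics of the step data along a neighbour-avoiding word -/

section Along

variable (a₀ : Fin d × Bool) {τ kc n : ℕ} {γ : Fin n → Fin d × Bool}

/-- The absolute neighbour site of step `t` in direction `b`: `v_{t+1} + e_b`. [folklore] -/
def nsite (γ : Fin n → Fin d × Bool) (t : ℕ) (b : Fin d × Bool) : Site d := wordPos γ (t + 1) + stepVec b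

/-- The relative neighbour, translated by the current endpoint, is the absolute neighbour. [folklore] -/
theorem cnbr_add_wordPos {t : ℕ} (ht : t < n) (b : Fin d × Bool) :
    cnbr (γ ⟨t, ht⟩) b + wordPos γ t = nsite γ t b := by
  rw [cnbr, nsite, wordPos_succ γ ht]; abel

/-- The new vertex is adjacent to each of its neighbour sites. [folklore] -/
theorem adj_succ_nsite (t : ℕ) (b : Fin d × Bool) : (zdGraph d).Adj (wordPos γ (t + 1)) (nsite γ t b) :=
  (zdGraph_adj_iff_stepVec _ _).2 ⟨b, rfl⟩

/-- **What a visible incidence is**: an earlier vertex `v_{t-j}`, `1 ≤ j ≤ t`, adjacent to the neighbour site. [folklore] -/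
theorem cvis_spec {t : ℕ} (ht : t < n) {b : Fin d × Bool} {q : Site d × ℕ}
    (hq : q ∈ cvis (danger τ (pre a₀ γ t)) (γ ⟨t, ht⟩) b) :
    1 ≤ q.2 ∧ q.2 ≤ t ∧ q.1 = wordPos γ (t - q.2) - wordPos γ t ∧ (zdGraph d).Adj (wordPos γ (t - q.2)) (nsite γ t b) := by
  obtain ⟨hqS, hadj⟩ := mem_cvis.1 hq
  obtain ⟨h1, h2, hq1⟩ := eq_of_mem_danger_pre a₀ ht.le hqS
  refine ⟨h1, h2, hq1, ?_⟩
  rw [← cnbr_add_wordPos ht, ← Literature.Probability.RandomPlanarGeometry.SAW.Zd.zdGraph_adj_sub_right _ _ (wordPos γ t),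
    add_sub_cancel_right, ← hq1]
  exact hadj

/-- **Retention**: an incidence `v_i ~ nsite` with `i < t` and age `t - i ≤ τ - 3` is visible at time `t`. [folklore] -/
theorem mem_cvis_of_adj (hτ : 2 ≤ τ) {t : ℕ} (ht : t < n) {b : Fin d × Bool} {i : ℕ} (hi : i < t) (hage : t - i + 3 ≤ τ)
    (hadj : (zdGraph d).Adj (wordPos γ i) (nsite γ t b)) :
    (wordPos γ i - wordPos γ t, t - i) ∈ cvis (danger τ (pre a₀ γ t)) (γ ⟨t, ht⟩) b := by
  refine mem_cvis.2 ⟨(mem_danger _ _).2 ⟨by omega, by omega, by omega, ?_, ?_⟩, ?_⟩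
  · rw [wordPos_pre a₀ γ ht.le (by omega), wordPos_pre a₀ γ ht.le le_rfl, show t - (t - i) = i by omega]
  · simp only
    have h1 : l1 (wordPos γ i - nsite γ t b) = 1 := l1_sub_of_adj hadj
    have h2 : l1 (nsite γ t b - wordPos γ t) ≤ 2 := by
      rw [nsite, wordPos_succ γ ht, show wordPos γ t + stepVec (γ ⟨t, ht⟩) + stepVec b - wordPos γ t =
        stepVec (γ ⟨t, ht⟩) + stepVec b by abel]
      exact (l1_add_le _ _).trans (by rw [l1_stepVec, l1_stepVec])
    have := l1_add_le (wordPos γ i - nsite γ t b) (nsite γ t b - wordPos γ t)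
    rw [sub_add_sub_cancel] at this
    omega
  · simp only
    rw [← Literature.Probability.RandomPlanarGeometry.SAW.Zd.zdGraph_adj_sub_right _ _ (wordPos γ t),
      ← cnbr_add_wordPos ht, add_sub_cancel_right] at hadj
    exact hadj

/-- **An active neighbour site is off the path.** [folklore] -/
theorem nsite_not_mem_pathSites (hch : chordEdges γ = ∅) {t : ℕ} (ht : t < n) {b : Fin d × Bool}
    (hact : cactive kc (danger τ (pre a₀ γ t)) (γ ⟨t, ht⟩) b = true) : nsite γ t b ∉ pathSites γ := by
  obtain ⟨hne, q, hq, -⟩ := (cactive_iff kc).1 hact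
  obtain ⟨h1, h2, -, hadj⟩ := cvis_spec a₀ ht hq
  intro hmem
  obtain ⟨k, hk, hkW⟩ := mem_pathSites.1 hmem
  have hA := adj_succ_nsite (γ := γ) t b
  rw [← hkW] at hA hadj
  rcases consecutive_of_adj hch (by omega) hk hA with h | h
  · rcases consecutive_of_adj hch (by omega) hk hadj with h' | h' <;> omega
  · -- k = t: the neighbour is the current endpoint, excluded by activity
    have hkt : k = t := by omega
    subst hkt
    apply hne
    have := cnbr_add_wordPos (γ := γ) ht b
    rw [← hkW] at this
    simpa using this

/-- The new incidence: `t + 1 ∈ incTimes γ (nsite γ t b)`. [folklore] -/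
theorem succ_mem_incTimes {t : ℕ} (ht : t < n) (b : Fin d × Bool) : t + 1 ∈ incTimes γ (nsite γ t b) :=
  mem_filter.2 ⟨mem_range.2 (by omega), adj_succ_nsite t b⟩

/-- A visible incidence is an incidence time. [folklore] -/
theorem sub_mem_incTimes {t : ℕ} (ht : t < n) {b : Fin d × Bool} {q : Site d × ℕ}
    (hq : q ∈ cvis (danger τ (pre a₀ γ t)) (γ ⟨t, ht⟩) b) : t - q.2 ∈ incTimes γ (nsite γ t b) := by
  obtain ⟨-, -, -, hadj⟩ := cvis_spec a₀ ht hq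
  exact mem_filter.2 ⟨mem_range.2 (by omega), hadj⟩

/-- Gap sites are forced (for every order). [folklore] -/
theorem mem_forcedSites_of_mem_gapSet (o : Orders d n) {t : ℕ} (ht : t ≤ n) {w : Site d} (hw : w ∈ gapSet γ t) :
    w ∈ forcedSites o γ := by
  rw [forcedSites, mem_image]
  refine ⟨(t, w), ?_, rfl⟩
  rw [chargedPairs, mem_union]; left
  rw [gapPairs, mem_biUnion]
  exact ⟨t, mem_range.2 (by omega), mem_image.2 ⟨w, hw, rfl⟩⟩

/-- Bad corner sites are forced. [folklore] -/
theorem mem_forcedSites_of_mem_badTimes {o : Orders d n} {s : Fin n} (hs : s ∈ badTimes o γ) :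
    cornerSite γ s ∈ forcedSites o γ := by
  rw [forcedSites, mem_image]
  refine ⟨((s : ℕ) + 2, cornerSite γ s), ?_, rfl⟩
  rw [chargedPairs, mem_union]; right
  exact mem_image.2 ⟨s, hs, rfl⟩

/-- **Unconditional payments are at sites forced for every order.** [folklore] -/
theorem forced_of_cuncond (hch : chordEdges γ = ∅) (o : Orders d n) {t : ℕ} (ht : t < n) {b : Fin d × Bool}
    (hunc : cuncond (danger τ (pre a₀ γ t)) (γ ⟨t, ht⟩) b = true) : nsite γ t b ∈ forcedSites o γ := by
  obtain ⟨q, hq, hq3⟩ := cuncond_iff.1 hunc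
  obtain ⟨hqS, hadj⟩ := mem_cvis.1 hq
  have hmem : cnbr (γ ⟨t, ht⟩) b ∈ ngapSet (danger τ (pre a₀ γ t)) (γ ⟨t, ht⟩) := by
    rw [ngapSet, mem_filter, mem_nbrSites, cnbr]
    exact ⟨(zdGraph_adj_iff_stepVec _ _).2 ⟨b, rfl⟩, q, hqS, by omega, hadj⟩
  have := add_mem_gapSet_of_mem_ngapSet a₀ hch ht hmem
  rw [cnbr_add_wordPos ht] at this
  exact mem_forcedSites_of_mem_gapSet o (by omega) this

/-- **The corner neighbour is the corner site** `v_{t-1} + e_t` of steps `t-1, t`, and the two steps are perpendicular. [folklore] -/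
theorem nsite_eq_cornerSite (hs : IsSAW γ) {t : ℕ} (ht : t < n) (ht1 : 1 ≤ t) {b : Fin d × Bool}
    (hact : cactive kc (danger τ (pre a₀ γ t)) (γ ⟨t, ht⟩) b = true) (hcor : ccorner (danger τ (pre a₀ γ t)) b = true) :
    nsite γ t b = cornerSite γ (t - 1) ∧ (γ ⟨t - 1, by omega⟩).1 ≠ (γ ⟨t, ht⟩).1 := by
  have hmem := ccorner_iff.1 hcor
  obtain ⟨-, -, hb⟩ := eq_of_mem_danger_pre a₀ ht.le hmem
  simp only at hb
  have hprev : wordPos γ t = wordPos γ (t - 1) + stepVec (γ ⟨t - 1, by omega⟩) := by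
    conv_lhs => rw [show t = t - 1 + 1 by omega]; exact wordPos_succ γ (by omega)
  have hb' : stepVec b = -stepVec (γ ⟨t - 1, by omega⟩) := by rw [hb, hprev]; abel
  constructor
  · rw [nsite, cornerSite, dif_pos (show t - 1 + 1 < n by omega), wordPos_succ γ ht, hb, hprev]
    have e1 : (⟨t - 1 + 1, (show t - 1 + 1 < n by omega)⟩ : Fin n) = ⟨t, ht⟩ := Fin.ext (by simp only; omega)
    rw [e1]; abel
  · refine Ne.symm (fst_ne_of_stepVec_ne ?_ ?_)
    · -- e_t ≠ e_{t-1}: otherwise the neighbour is the endpoint (inactive)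
      intro he
      obtain ⟨hne, -⟩ := (cactive_iff kc).1 hact
      apply hne
      rw [cnbr, hb', he, add_neg_cancel]
    · -- e_t ≠ -e_{t-1}: no immediate reversal in a self-avoiding word
      intro he
      have : wordPos γ (t + 1) = wordPos γ (t - 1) := by rw [wordPos_succ γ ht, hprev, he]; abel
      have := hs (t + 1) (t - 1) (by omega) (by omega) this
      omega

/-- **Conditional payments, made when the corner is bad, are at forced sites.** [folklore] -/
theorem forced_of_ccorner (hs : IsSAW γ) (hch : chordEdges γ = ∅) (o : Orders d n) {t : ℕ} (ht : t < n) (ht1 : 1 ≤ t)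
    {b : Fin d × Bool} (hact : cactive kc (danger τ (pre a₀ γ t)) (γ ⟨t, ht⟩) b = true)
    (hcor : ccorner (danger τ (pre a₀ γ t)) b = true) (hbad : IsBad o γ (t - 1)) : nsite γ t b ∈ forcedSites o γ := by
  classical
  obtain ⟨hW, hax⟩ := nsite_eq_cornerSite a₀ hs ht ht1 hact hcor
  have hoff := nsite_not_mem_pathSites a₀ (kc := kc) hch ht hact
  by_cases hc : IsCorner γ (t - 1)
  · have hbt : (⟨t - 1, by omega⟩ : Fin n) ∈ badTimes o γ := mem_badTimes.2 ⟨hc, hbad⟩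
    rw [hW]; exact mem_forcedSites_of_mem_badTimes hbt
  · -- not a genuine corner: an older incidence exists, so the site is a gap site at time t+1
    have hold : ∃ i < t - 1, (zdGraph d).Adj (wordPos γ i) (nsite γ t b) := by
      by_contra hno
      push Not at hno
      apply hc
      refine ⟨by omega, ?_, by rw [← hW]; exact hoff, fun i hi => by rw [← hW]; exact hno i (mem_range.1 hi)⟩
      have e1 : (⟨t - 1 + 1, (by omega : t - 1 + 1 < n)⟩ : Fin n) = ⟨t, ht⟩ := Fin.ext (by simp only; omega)
      rw [e1]; exact hax
    obtain ⟨i, hi, hiA⟩ := hold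
    exact mem_forcedSites_of_mem_gapSet o (by omega)
      (mem_gapSet.2 ⟨adj_succ_nsite t b, hoff, i, by omega, hiA⟩)

end Along

end Summit.CriticalPhenomena.PercolationContinuityZ3.Theorems.Pcint
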